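import Summits.Schanuel.Schanuel.Theorems.ZilberEacGraphLinearWitness
import Summits.Schanuel.Schanuel.Theorems.ZilberEacGraphLinearTools
import HarnessLib

/-!
# The equimodular class, XXIV: exponential points of a fibre curve with EVERY large label at a
# nonzero root of the top row

HONEST FRAMING.  Cell `pub-schanuel` (Zilber's Exponential-Algebraic Closedness, case ladder;
host summit Schanuel), seat 2, gen 24.  Gen 22/23 (`exists_expPoint_near_label`,
`exists_labelled_expPoints`) produced, for a `y₀`-LINEAR fibre `A(x₀)y₀ + B(x₀)`, solutions of
`A(z)e^z + B(z) = 0` near every large label `τ + 2πik`.  Here the fibre polynomial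
`Q = Σ_j q_j(s) t^j ∈ ℂ[s][t]` is ARBITRARY (rows of degree `≤ N`, top row `T ≠ 0`):
**`exists_fibre_expPoint_near_label`** — if `θ = e^τ ≠ 0` is a root of `T`, then for every `ε > 0`
and every large `k` some `z` with `‖z - τ - 2πik‖ < ε` solves `Q(z, e^z) = 0` (zero persistence for
`Φ(u, ζ) = Σ_j (Σ_i q_{j,i} u^{N-i}(1 + uζ)^i)(θe^ζ)^j = u^N Q(1/u + ζ, θ e^ζ)` at `u = 1/(τ + 2πik) → 0`,
whose limit `T(θe^ζ)` vanishes at `ζ = 0` and is not identically zero);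
**`exists_fibre_labelled_expPoints`** packages the sequence `z_m` with labels `k₀ + m`, beyond any
radius, `‖z_m‖ → ∞`, `‖z_m‖ ≤ ‖τ‖ + 1 + 7(k₀ + m)`; **`norm_exp_sub_le_of_label`**: at such a point
`‖e^{z} - θ‖ ≤ 2‖θ‖ε`, so `e^{z}` is the value of the analytic branch of file XXIII when `θ` is a
simple root.  [folklore: Hurwitz/Rouché zero persistence]; nothing here is specific to Schanuel's
conjecture (neither used nor implied); Mantova–Masser's question and EC(3,2) stay OPEN.
-/

noncomputable section

open Filter Topology Polynomial Complex Metric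

set_option linter.dupNamespace false

namespace Summit.Schanuel.Schanuel.Theorems

/-- **`‖e^z - θ‖ ≤ 2‖θ‖ε` at a point with label distance `< ε ≤ 1`** (`θ = e^τ`). [folklore] -/
theorem norm_exp_sub_le_of_label {z τ θ : ℂ} (hτ : Complex.exp τ = θ) {k : ℤ} {ε : ℝ}
    (hε1 : ε ≤ 1) (hz : ‖z - τ - k * (2 * Real.pi * I)‖ < ε) :
    ‖Complex.exp z - θ‖ ≤ 2 * ‖θ‖ * ε := by
  set ζ : ℂ := z - τ - k * (2 * Real.pi * I) with hζ
  have hexp : Complex.exp z = θ * Complex.exp ζ := by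
    have hper : Complex.exp ((k : ℂ) * (2 * Real.pi * I)) = 1 := Complex.exp_int_mul_two_pi_mul_I k
    rw [← hτ, ← Complex.exp_add, hζ, show τ + (z - τ - k * (2 * Real.pi * I)) =
      z - k * (2 * Real.pi * I) by ring, Complex.exp_sub, hper, div_one]
  rw [hexp, show θ * Complex.exp ζ - θ = θ * (Complex.exp ζ - 1) by ring, norm_mul]
  have h1 : ‖Complex.exp ζ - 1‖ ≤ 2 * ‖ζ‖ := Complex.norm_exp_sub_one_le (by linarith [hz.le])
  nlinarith [norm_nonneg θ, norm_nonneg ζ, hz.le]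

/-- **Exponential points of a fibre curve with every large label.**  See the module docstring.
(new) -/
theorem exists_fibre_expPoint_near_label (Q : ℂ[X][X]) (N : ℕ) (hN : ∀ j, (Q.coeff j).natDegree ≤ N)
    (T : ℂ[X]) (hT : ∀ j, T.coeff j = (Q.coeff j).coeff N) (hT0 : T ≠ 0) {θ : ℂ} (hθ0 : θ ≠ 0)
    (hTθ : T.IsRoot θ) (τ : ℂ) (hτ : Complex.exp τ = θ) {ε : ℝ} (hε : 0 < ε) :
    ∃ K : ℕ, ∀ k : ℕ, K ≤ k → ∃ z : ℂ, ‖z - τ - (k : ℂ) * (2 * Real.pi * I)‖ < ε ∧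
      (Q.map (Polynomial.evalRingHom z)).eval (Complex.exp z) = 0 := by
  classical
  -- the rescaled function
  set Φ : ℂ → ℂ → ℂ := fun u ζ => ∑ j ∈ Finset.range (Q.natDegree + 1),
      (∑ i ∈ Finset.range (N + 1), (Q.coeff j).coeff i * u ^ (N - i) * (1 + u * ζ) ^ i) *
        (θ * Complex.exp ζ) ^ j with hΦ
  have hcont : Continuous fun p : ℂ × ℂ => Φ p.1 p.2 := by
    simp only [hΦ]
    fun_prop
  have hdiff : ∀ u, Differentiable ℂ (Φ u) := by
    intro u
    simp only [hΦ]
    fun_prop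
  -- the key identity `Σ_i c_i u^{N-i}(1 + uζ)^i = u^N C(1/u + ζ)` for `u ≠ 0`
  have hresc : ∀ (C : Polynomial ℂ), C.natDegree ≤ N → ∀ u ζ : ℂ, u ≠ 0 →
      (∑ i ∈ Finset.range (N + 1), C.coeff i * u ^ (N - i) * (1 + u * ζ) ^ i) =
        u ^ N * C.eval (u⁻¹ + ζ) := by
    intro C hC u ζ hu
    rw [Polynomial.eval_eq_sum_range' (Nat.lt_succ_of_le hC), Finset.mul_sum]
    refine Finset.sum_congr rfl fun i hi => ?_
    have hi' : i ≤ N := Nat.lt_succ_iff.1 (Finset.mem_range.1 hi)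
    have e1 : (u⁻¹ + ζ) ^ i = u⁻¹ ^ i * (1 + u * ζ) ^ i := by
      rw [← mul_pow]; congr 1; field_simp
    rw [e1, inv_pow, pow_sub₀ _ hu hi']
    ring
  -- the limit function at `u = 0`
  have hΦ0 : ∀ ζ, Φ 0 ζ = T.eval (θ * Complex.exp ζ) := by
    intro ζ
    have h0 : ∀ (C : Polynomial ℂ), (∑ i ∈ Finset.range (N + 1),
        C.coeff i * (0 : ℂ) ^ (N - i) * (1 + 0 * ζ) ^ i) = C.coeff N := by
      intro C
      rw [Finset.sum_eq_single N]
      · simp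
      · intro i hi hne
        have : N - i ≠ 0 := by have := Finset.mem_range.1 hi; omega
        rw [zero_pow this]; ring
      · intro h; exact absurd (Finset.self_mem_range_succ N) h
    simp only [hΦ, h0]
    have hTdeg : T.natDegree ≤ Q.natDegree := by
      rw [Polynomial.natDegree_le_iff_coeff_eq_zero]
      intro j hj
      rw [hT, Polynomial.coeff_eq_zero_of_natDegree_lt (p := Q) hj, Polynomial.coeff_zero]
    rw [Polynomial.eval_eq_sum_range' (Nat.lt_succ_of_le hTdeg)]
    refine Finset.sum_congr rfl fun j _ => ?_
    rw [hT]
  have hzero : Φ 0 0 = 0 := by rw [hΦ0, Complex.exp_zero, mul_one]; exact hTθ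
  have hne : ∃ ζ, Φ 0 ζ ≠ 0 := by
    obtain ⟨c, hc⟩ := Infinite.exists_notMem_finset (insert (0 : ℂ) T.roots.toFinset)
    rw [Finset.mem_insert, not_or, Multiset.mem_toFinset, Polynomial.mem_roots hT0] at hc
    refine ⟨Complex.log (c / θ), ?_⟩
    rw [hΦ0, Complex.exp_log (div_ne_zero hc.1 hθ0), mul_div_cancel₀ _ hθ0]
    exact hc.2
  obtain ⟨δ, hδ, hnear⟩ := exists_zero_near_of_near_param hcont hdiff hne hzero hε
  -- large labels give small parameters
  obtain ⟨K, hK⟩ : ∃ K : ℕ, ∀ k : ℕ, K ≤ k → δ⁻¹ + ‖τ‖ < 2 * Real.pi * k := by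
    obtain ⟨K, hK⟩ := exists_nat_gt ((δ⁻¹ + ‖τ‖) / (2 * Real.pi))
    refine ⟨K, fun k hk => ?_⟩
    rw [div_lt_iff₀ Real.two_pi_pos] at hK
    have : (K : ℝ) ≤ k := by exact_mod_cast hk
    nlinarith [Real.pi_pos]
  refine ⟨K, fun k hk => ?_⟩
  set s : ℂ := τ + (k : ℂ) * (2 * Real.pi * I) with hs
  have hsnorm : δ⁻¹ < ‖s‖ := by
    have h1 : ‖(k : ℂ) * (2 * Real.pi * I)‖ = 2 * Real.pi * k := by
      rw [norm_mul, Complex.norm_natCast]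
      simp [abs_of_pos Real.pi_pos]
      ring
    have h2 : ‖(k : ℂ) * (2 * Real.pi * I)‖ - ‖τ‖ ≤ ‖s‖ := by
      rw [hs]
      have := norm_sub_norm_le ((k : ℂ) * (2 * Real.pi * I)) (-τ)
      rw [norm_neg, sub_neg_eq_add, add_comm] at this
      linarith
    linarith [hK k hk]
  have hs0 : s ≠ 0 := by
    intro h; rw [h, norm_zero] at hsnorm; exact absurd hsnorm (not_lt.2 (by positivity))
  have hus : ‖s⁻¹ - 0‖ < δ := by
    rw [sub_zero, norm_inv]
    have hspos : 0 < ‖s‖ := norm_pos_iff.2 hs0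
    calc ‖s‖⁻¹ < (δ⁻¹)⁻¹ := (inv_lt_inv₀ hspos (by positivity)).2 hsnorm
      _ = δ := inv_inv δ
  obtain ⟨ζ, hζ, hΦζ⟩ := hnear s⁻¹ hus
  refine ⟨s + ζ, ?_, ?_⟩
  · have e : s + ζ - τ - (k : ℂ) * (2 * Real.pi * I) = ζ := by rw [hs]; ring
    rw [e]; simpa using hζ
  -- unfold the zero of `Φ`
  have hu0 : s⁻¹ ≠ 0 := inv_ne_zero hs0
  have hexp : θ * Complex.exp ζ = Complex.exp (s + ζ) := by
    have hper : Complex.exp ((k : ℂ) * (2 * Real.pi * I)) = 1 := by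
      have := Complex.exp_int_mul_two_pi_mul_I (k : ℤ)
      exact_mod_cast this
    rw [← hτ, hs, show τ + (k : ℂ) * (2 * Real.pi * I) + ζ =
      (τ + ζ) + (k : ℂ) * (2 * Real.pi * I) by ring, Complex.exp_add, Complex.exp_add, hper, mul_one]
  have h1 : Φ s⁻¹ ζ = s⁻¹ ^ N * (Q.map (Polynomial.evalRingHom (s + ζ))).eval (Complex.exp (s + ζ)) := by
    rw [hΦ]
    simp only
    rw [evalPP_eq_sum Q (s + ζ) _ (Nat.lt_succ_self _), Finset.mul_sum]
    refine Finset.sum_congr rfl fun j _ => ?_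
    rw [hresc (Q.coeff j) (hN j) _ _ hu0, inv_inv, hexp]
    ring
  rw [h1] at hΦζ
  exact (mul_eq_zero.1 hΦζ).resolve_left (pow_ne_zero _ hu0)

/-- **Exponential points with all large labels, packaged** (labels `k₀ + m`, label distance
`< ε ≤ 1`, beyond the radius `R`, norms `→ ∞`, `‖z_m‖ ≤ ‖τ‖ + 1 + 7(k₀ + m)`). (new) -/
theorem exists_fibre_labelled_expPoints (Q : ℂ[X][X]) (N : ℕ) (hN : ∀ j, (Q.coeff j).natDegree ≤ N)
    (T : ℂ[X]) (hT : ∀ j, T.coeff j = (Q.coeff j).coeff N) (hT0 : T ≠ 0) {θ : ℂ} (hθ0 : θ ≠ 0)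
    (hTθ : T.IsRoot θ) (τ : ℂ) (hτ : Complex.exp τ = θ) {ε : ℝ} (hε : 0 < ε) (hε1 : ε ≤ 1)
    (R : ℝ) :
    ∃ (k₀ : ℕ) (z : ℕ → ℂ), (∀ m, ‖z m - τ - ((k₀ + m : ℕ) : ℂ) * (2 * Real.pi * I)‖ < ε) ∧
      (∀ m, (Q.map (Polynomial.evalRingHom (z m))).eval (Complex.exp (z m)) = 0) ∧
      (∀ m, R < ‖z m‖) ∧ Tendsto (fun m => ‖z m‖) atTop atTop ∧
      ∀ m, ‖z m‖ ≤ ‖τ‖ + 1 + 7 * ((k₀ + m : ℕ) : ℝ) := by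
  obtain ⟨K, hK⟩ := exists_fibre_expPoint_near_label Q N hN T hT hT0 hθ0 hTθ τ hτ hε
  obtain ⟨K', hK'⟩ : ∃ K' : ℕ, ∀ k : ℕ, K' ≤ k → R + ‖τ‖ + 1 < 2 * Real.pi * k := by
    obtain ⟨K', hK'⟩ := exists_nat_gt ((R + ‖τ‖ + 1) / (2 * Real.pi))
    refine ⟨K', fun k hk => ?_⟩
    rw [div_lt_iff₀ Real.two_pi_pos] at hK'
    have : (K' : ℝ) ≤ k := by exact_mod_cast hk
    nlinarith [Real.pi_pos]
  set k₀ : ℕ := max K K' with hk₀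
  have hzex : ∀ m : ℕ, ∃ z : ℂ, ‖z - τ - ((k₀ + m : ℕ) : ℂ) * (2 * Real.pi * I)‖ < ε ∧
      (Q.map (Polynomial.evalRingHom z)).eval (Complex.exp z) = 0 := fun m =>
    hK (k₀ + m) ((le_max_left K K').trans (Nat.le_add_right _ _))
  choose z hzlab hzeq using hzex
  have hzlab1 : ∀ m, ‖z m - τ - ((k₀ + m : ℕ) : ℂ) * (2 * Real.pi * I)‖ < 1 :=
    fun m => (hzlab m).trans_le hε1
  have hnk : ∀ m, ‖((k₀ + m : ℕ) : ℂ) * (2 * Real.pi * I)‖ = 2 * Real.pi * ((k₀ + m : ℕ) : ℝ) := by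
    intro m
    rw [norm_mul, Complex.norm_natCast]
    simp [abs_of_pos Real.pi_pos]
    ring
  have hzlow : ∀ m, 2 * Real.pi * ((k₀ + m : ℕ) : ℝ) - ‖τ‖ - 1 ≤ ‖z m‖ := by
    intro m
    have h2 := norm_sub_le_norm_sub_add_norm_sub (((k₀ + m : ℕ) : ℂ) * (2 * Real.pi * I))
      (z m - τ) 0
    rw [sub_zero, sub_zero, norm_sub_rev, hnk m] at h2
    have h3 : ‖z m - τ‖ ≤ ‖z m‖ + ‖τ‖ := norm_sub_le _ _
    linarith [hzlab1 m]
  have hzup : ∀ m, ‖z m‖ ≤ ‖τ‖ + 1 + 7 * ((k₀ + m : ℕ) : ℝ) := by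
    intro m
    have h1 : ‖z m‖ ≤ ‖z m - τ - ((k₀ + m : ℕ) : ℂ) * (2 * Real.pi * I)‖ + ‖τ‖ +
        ‖((k₀ + m : ℕ) : ℂ) * (2 * Real.pi * I)‖ := by
      have e : z m = (z m - τ - ((k₀ + m : ℕ) : ℂ) * (2 * Real.pi * I)) + τ +
          ((k₀ + m : ℕ) : ℂ) * (2 * Real.pi * I) := by ring
      calc ‖z m‖ = ‖(z m - τ - ((k₀ + m : ℕ) : ℂ) * (2 * Real.pi * I)) + τ +
            ((k₀ + m : ℕ) : ℂ) * (2 * Real.pi * I)‖ := by rw [← e]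
        _ ≤ _ := norm_add₃_le
    rw [hnk m] at h1
    have hk0 : (0 : ℝ) ≤ ((k₀ + m : ℕ) : ℝ) := Nat.cast_nonneg _
    nlinarith [hzlab1 m, Real.pi_lt_d2, Real.pi_pos]
  refine ⟨k₀, z, hzlab, hzeq, fun m => ?_, ?_, hzup⟩
  · have := hK' (k₀ + m) ((le_max_right K K').trans (Nat.le_add_right _ _))
    linarith [hzlow m]
  · refine tendsto_atTop_mono hzlow ?_
    have h1 : Tendsto (fun m : ℕ => 2 * Real.pi * ((k₀ + m : ℕ) : ℝ)) atTop atTop := by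
      refine Tendsto.const_mul_atTop Real.two_pi_pos ?_
      exact tendsto_natCast_atTop_atTop.comp (tendsto_add_atTop_nat k₀ |>.congr fun m => by ring_nf)
    have h2 := tendsto_atTop_add_const_right atTop (-‖τ‖ - 1) h1
    exact h2.congr fun m => by ring

end Summit.Schanuel.Schanuel.Theorems
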